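import Literature.NumberTheory.Automorphic.ArchU21SplitOrbitNormalisedPi     -- ★ (A3) p850967: `prod_normaliser_smul_integral_pi_eq_smul_integral_pi_prod`
import Literature.NumberTheory.Automorphic.ArchU21SplitPlaceTransport       -- ★ (A2) p850933: `descConj_cosetCongr_subgroup`; brings `cosetCongr`, `isFiniteMeasureOnCompacts_map_cosetCongr`
import HarnessLib

/-!
# (A2)+(A3) of the E3 assembly: transport every split factor to `U(J₃)(ℂ) ⧸ torusU`, then unfold the finite product to `Π_i (K_i × N)`

Topic `NumberTheory/Automorphic`; namespace `Literature.NumberTheory.Automorphic.UnitaryGroup`.  THEOREMS ONLY (no `def`, no `instance`, no notation,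
no `sorry`).  Cell `pub/hodgecm-mathlib`, crux H413 (`stmt-HodgeConjecture-24833`), F0∕P3c line LH3 «E3 ASSEMBLY», letter L1 of
`HcOrbitalFamiliesStatement`, clause (I₂): the composite brick **(A2)+(A3)** of F0P3b-p01 (g16)'s `SPEC-E3-assembly.v1` §4 (RULING #13, 2026-09-02) — the
form in which the (A5) assembly `Rogawski1990/ArchOrbFamGExtSmoothInRegG` consumes ★ (A3) `ArchU21SplitOrbitNormalisedPi` (LH1-p01 (g7), p850967) and ★ (A2)
`ArchU21SplitPlaceTransport` (LH10-p01 (g4), p850933).  Count-neutral measure-theoretic bookkeeping; HC_CM stays proved only modulo its printed citations.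

THE STATEMENT.  Finite index type `ι` (the split-chart places `w ∈ S′`); per index an ABSTRACT topological group `U_i` (the local group `U(α)_w`), a subgroup
`T′_i` (the local chart torus), a σ-finite measure `μ_i` finite on compacta on `U_i ⧸ T′_i` (the local invariant quotient measure `ν′_w ∕ t_w`), a continuous
isomorphism `φ_i : U_i ≃ₜ* U(J₃)(ℂ)` with `φ_i⁻¹(torusU) = T′_i` (★ (A2)), a base point `γ_i` central in `T′_i` with `φ_i γ_i = t_i = m_i s_i s_i = diag(boostEig c_i)`,
`x_i = c_i 0 ≠ 0` (off the real wall), and the Iwasawa reading of the transported measure `(Ψ_i)_* μ_i = C_i • ((k, n) ↦ k n T)_*(κ_i ⊗ μ_{N,i})`,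
`Ψ_i = cosetCongr φ_i` (★ (A2) `exists_splitPlace_transport_smul_map`).  Then for every s-finite second-countable spectator `(Ω, ρ)` (the compact-place factor)
and every continuous Banach-valued `F` on `(Π_i U_i) × Ω`:

  `(Π_i Δ(c_i)) • ∫ F((y_i γ_i y_i⁻¹)_i, ω) d((⊗_i μ_i) ⊗ ρ) = (Π_i C_i) • ∫ F((φ_i⁻¹(k_i · m_i s_i n_i s_i · k_i⁻¹))_i, ω) d((⊗_i (κ_i ⊗ μ_{N,i})) ⊗ ρ)`,

`Δ(c) = |eˣ − e⁻ˣ| · |e^{x+iθ} − e^{iφ}| · |e^{−x+iθ} − e^{iφ}|` the split-place normaliser `|D_G|^{1∕2}` (Rogawski §4.9 (4.9.1)).  No integrability, no Fubini: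
the change of variables `Ψ × id_Ω` is a measure-preserving measurable EQUIVALENCE `(⊗_i μ_i) ⊗ ρ → (⊗_i (Ψ_i)_* μ_i) ⊗ ρ` (Mathlib `measurePreserving_pi`,
`MeasurePreserving.prod`, `MeasurePreserving.integral_comp'`), the integrand transports pointwise (★ `descConj_cosetCongr_subgroup`: `y γ_i y⁻¹ = φ_i⁻¹(Ψ_i(y) t_i Ψ_i(y)⁻¹)`),
and ★ (A3) `prod_normaliser_smul_integral_pi_eq_smul_integral_pi_prod` unfolds the transported side.

References: J. Rogawski, *Automorphic Representations of Unitary Groups in Three Variables*, Ann. of Math. Stud. 123 (1990), §4.9 (4.9.1)–(4.9.2) p. 55, §4.13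
p. 70 [Rogawski1990]; S. Gelbart, *Automorphic Forms on Adele Groups*, Ann. of Math. Stud. 83 (1975), §10 p. 155 (10.19) [Gelbart1975]; A. Deitmar, S. Echterhoff,
*Principles of Harmonic Analysis*, 2nd ed. (2014), Thm. 1.5.3 [DeitmarEchterhoff2014].
-/

set_option autoImplicit false

noncomputable section

open MeasureTheory MeasureTheory.Measure Set Complex Topology
open Literature.MeasureTheory.Group
open scoped ENNReal NNReal

namespace Literature.NumberTheory.Automorphic

namespace UnitaryGroup

section TransportPi

variable {ι : Type*} [Fintype ι] {J : Matrix (Fin 3) (Fin 3) ℂ} (hJ : J = (StdForm.antidiagonal 3).over ℂ)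
  [MeasurableSpace ↥(unitaryGroupOfForm (starRingEnd ℂ) J)] [BorelSpace ↥(unitaryGroupOfForm (starRingEnd ℂ) J)]
  [MeasurableSpace (↥(unitaryGroupOfForm (starRingEnd ℂ) J) ⧸ torusU (starRingEnd ℂ) J)] [BorelSpace (↥(unitaryGroupOfForm (starRingEnd ℂ) J) ⧸ torusU (starRingEnd ℂ) J)]
  -- the local groups, their tori, the local quotient measures
  {U : ι → Type*} [∀ i, Group (U i)] [∀ i, TopologicalSpace (U i)]
  (T' : ∀ i, Subgroup (U i)) [∀ i, MeasurableSpace (U i ⧸ T' i)] [∀ i, BorelSpace (U i ⧸ T' i)]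
  (μ : ∀ i, Measure (U i ⧸ T' i)) [∀ i, SigmaFinite (μ i)] [∀ i, IsFiniteMeasureOnCompacts (μ i)]
  -- the transports
  (φ : ∀ i, U i ≃ₜ* ↥(unitaryGroupOfForm (starRingEnd ℂ) J))
  (hφT : ∀ i (g : U i), (φ i).toMulEquiv g ∈ torusU (starRingEnd ℂ) J ↔ g ∈ T' i)
  -- Iwasawa data on `U(J₃)(ℂ)`
  (K : ι → Subgroup ↥(unitaryGroupOfForm (starRingEnd ℂ) J)) (κ : ∀ i, Measure ↥(K i)) [∀ i, SigmaFinite (κ i)]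
  (μN : ι → Measure ↥(unipotentU (starRingEnd ℂ) J)) [∀ i, IsHaarMeasure (μN i)]
  {C : ι → ℝ≥0}
  (hμC : ∀ i, (μ i).map (cosetCongr (φ i).toMulEquiv (T' i) (torusU (starRingEnd ℂ) J) (hφT i)) = C i • Measure.map
    (fun p : ↥(K i) × ↥(unipotentU (starRingEnd ℂ) J) =>
      (QuotientGroup.mk ((p.1 : ↥(unitaryGroupOfForm (starRingEnd ℂ) J)) * (p.2 : ↥(unitaryGroupOfForm (starRingEnd ℂ) J))) :
        ↥(unitaryGroupOfForm (starRingEnd ℂ) J) ⧸ torusU (starRingEnd ℂ) J))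
    ((κ i).prod (μN i)))

include hJ hμC in
/-- **(A2)+(A3): TRANSPORT EVERY SPLIT FACTOR TO `U(J₃)(ℂ) ⧸ torusU`, THEN UNFOLD THE PRODUCT TO `Π_i (K_i × N)`** — the finite-product normalised split orbital
integral read on abstract local groups `U_i` with continuous isomorphisms `φ_i : U_i ≃ U(J₃)(ℂ)` carrying `T′_i` onto `torusU` (`hφT`), base points `γ_i` central in `T′_i` with
`φ_i γ_i = t_i = m_i s_i s_i = diag(boostEig c_i)`, `x_i = c_i 0 ≠ 0`, and local quotient measures `μ_i` (σ-finite, finite on compacta) whose transports have the Iwasawa form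
`(Ψ_i)_* μ_i = C_i • ((k, n) ↦ k n T)_*(κ_i ⊗ μ_{N,i})` (`hμC`, ★ (A2) `exists_splitPlace_transport_smul_map`), against an s-finite second-countable spectator `(Ω, ρ)` and a
continuous Banach-valued `F` on `(Π_i U_i) × Ω`:
**`(Π_i Δ(c_i)) • ∫ F((y_i γ_i y_i⁻¹)_i, ω) d((⊗_i μ_i) ⊗ ρ) = (Π_i C_i) • ∫ F((φ_i⁻¹(k_i (m_i s_i n_i s_i) k_i⁻¹))_i, ω) d((⊗_i (κ_i ⊗ μ_{N,i})) ⊗ ρ)`**,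
`Δ(c) = |eˣ − e⁻ˣ|·|e^{x+iθ} − e^{iφ}|·|e^{−x+iθ} − e^{iφ}|` (★ (A3) `prod_normaliser_smul_integral_pi_eq_smul_integral_pi_prod` after the measure-preserving change of variables
`Ψ = Π_i cosetCongr φ_i` × `id_Ω`, Mathlib `measurePreserving_pi`, `MeasurePreserving.integral_comp'`; pointwise ★ `descConj_cosetCongr_subgroup`).
[cite: Rogawski1990, §4.9 (4.9.1)–(4.9.2) p. 55; §4.13 p. 70] [cite: Gelbart1975, §10 p. 155 (10.19)] [cite: DeitmarEchterhoff2014, Thm. 1.5.3] -/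
theorem prod_normaliser_smul_integral_pi_descConj_eq_smul_integral_pi_prod_symm
    {γ : ∀ i, U i} (hγ : ∀ i, ∀ m ∈ T' i, m * γ i = γ i * m)
    {t m s : ι → ↥(unitaryGroupOfForm (starRingEnd ℂ) J)} (hφγ : ∀ i, φ i (γ i) = t i)
    (ht : ∀ i, t i ∈ torusU (starRingEnd ℂ) J) (hs : ∀ i, s i ∈ torusU (starRingEnd ℂ) J) (htms : ∀ i, t i = m i * s i * s i)
    (c : ι → Fin 3 → ℝ) (hx : ∀ i, c i 0 ≠ 0)
    {dt ds : ι → Fin 3 → ℂˣ} (hdt : ∀ i, glDiagonal 3 ℂ (dt i) = (t i : GL (Fin 3) ℂ)) (hdtc : ∀ i j, (dt i j : ℂ) = boostEig (c i) j)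
    (hds : ∀ i, glDiagonal 3 ℂ (ds i) = (s i : GL (Fin 3) ℂ)) (hdsc : ∀ i j, (ds i j : ℂ) = boostEig ![c i 0 / 2, 0, 0] j)
    {Ω : Type*} [TopologicalSpace Ω] [MeasurableSpace Ω] [OpensMeasurableSpace Ω] [SecondCountableTopology Ω] (ρ : Measure Ω) [SFinite ρ]
    {E : Type*} [NormedAddCommGroup E] [NormedSpace ℝ E]
    (F : (∀ i, U i) × Ω → E) (hF : Continuous F) :
    (∏ i, (|Real.exp (c i 0) - Real.exp (-c i 0)| * ‖Complex.exp ((c i 0 : ℂ) + (c i 2 : ℂ) * I) - Complex.exp ((c i 1 : ℂ) * I)‖ *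
        ‖Complex.exp (-(c i 0 : ℂ) + (c i 2 : ℂ) * I) - Complex.exp ((c i 1 : ℂ) * I)‖)) •
      ∫ q : (∀ i, U i ⧸ T' i) × Ω, F (fun i => descConj (γ i) (T' i) (hγ i) id (q.1 i), q.2) ∂((Measure.pi μ).prod ρ) =
      (∏ i, (C i : ℝ)) • ∫ q : ((i : ι) → ↥(K i) × ↥(unipotentU (starRingEnd ℂ) J)) × Ω,
        F (fun i => (φ i).symm (((q.1 i).1 : ↥(unitaryGroupOfForm (starRingEnd ℂ) J)) * (m i * s i * ((q.1 i).2 : ↥(unitaryGroupOfForm (starRingEnd ℂ) J)) * s i) *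
          ((q.1 i).1 : ↥(unitaryGroupOfForm (starRingEnd ℂ) J))⁻¹), q.2) ∂((Measure.pi fun i => (κ i).prod (μN i)).prod ρ) := by
  haveI : LocallyCompactSpace ↥(unitaryGroupOfForm (starRingEnd ℂ) J) := locallyCompactSpace_unitaryGroupOfForm_complex J
  haveI : SecondCountableTopology ↥(unitaryGroupOfForm (starRingEnd ℂ) J) := secondCountableTopology_unitaryGroupOfForm_complex J
  have he : ∀ i, Continuous (φ i).toMulEquiv := fun i => (φ i).continuous
  have hes : ∀ i, Continuous (φ i).toMulEquiv.symm := fun i => (φ i).symm.continuous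
  -- the transported measures `μ'_i := (Ψ_i)_* μ_i` on `U(J₃) ⧸ torusU` are σ-finite (Radon on a second-countable locally compact space)
  obtain ⟨μ', hμ'⟩ : ∃ μ' : ι → Measure (↥(unitaryGroupOfForm (starRingEnd ℂ) J) ⧸ torusU (starRingEnd ℂ) J),
      μ' = fun i => (μ i).map (cosetCongr (φ i).toMulEquiv (T' i) (torusU (starRingEnd ℂ) J) (hφT i)) := ⟨_, rfl⟩
  have hμ'i : ∀ i, μ' i = (μ i).map (cosetCongr (φ i).toMulEquiv (T' i) (torusU (starRingEnd ℂ) J) (hφT i)) := fun i => by rw [hμ']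
  haveI hμ'σ : ∀ i, SigmaFinite (μ' i) := fun i => by
    haveI := isFiniteMeasureOnCompacts_map_cosetCongr (φ i).toMulEquiv (T' i) (torusU (starRingEnd ℂ) J) (hφT i) (he i) (hes i) (μ i)
    rw [hμ'i i]
    infer_instance
  -- Ψ := Π_i cosetCongr φ_i is measure preserving `⊗_i μ_i → ⊗_i μ'_i`, and so is `Ψ × id_Ω`
  have hΨ : MeasurePreserving (fun (x : ∀ i, U i ⧸ T' i) (i : ι) => cosetCongr (φ i).toMulEquiv (T' i) (torusU (starRingEnd ℂ) J) (hφT i) (x i))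
      (Measure.pi μ) (Measure.pi μ') :=
    measurePreserving_pi _ _ fun i => ⟨(continuous_cosetCongr _ _ _ _ (he i)).measurable, by rw [hμ'i i]⟩
  have hΨρ := hΨ.prod (MeasurePreserving.id ρ)
  -- the same map as a measurable equivalence (for `MeasurePreserving.integral_comp'`, which needs no measurability of the integrand)
  obtain ⟨f, hf⟩ : ∃ f : ((∀ i, U i ⧸ T' i) × Ω) ≃ᵐ ((ι → ↥(unitaryGroupOfForm (starRingEnd ℂ) J) ⧸ torusU (starRingEnd ℂ) J) × Ω),
      ⇑f = Prod.map (fun (x : ∀ i, U i ⧸ T' i) (i : ι) => cosetCongr (φ i).toMulEquiv (T' i) (torusU (starRingEnd ℂ) J) (hφT i) (x i)) id :=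
    ⟨MeasurableEquiv.prodCongr (MeasurableEquiv.piCongrRight fun i =>
        (cosetCongrHomeomorph (φ i).toMulEquiv (T' i) (torusU (starRingEnd ℂ) J) (hφT i) (he i) (hes i)).toMeasurableEquiv) (MeasurableEquiv.refl Ω),
      funext fun q => rfl⟩
  have hfmp : MeasurePreserving f ((Measure.pi μ).prod ρ) ((Measure.pi μ').prod ρ) := by
    rw [hf]
    exact hΨρ
  -- the two integrands on the `U(J₃)` side
  obtain ⟨Φ, hΦ⟩ : ∃ Φ : (ι → ↥(unitaryGroupOfForm (starRingEnd ℂ) J)) × Ω → E, Φ = fun p => F (fun i => (φ i).symm (p.1 i), p.2) := ⟨_, rfl⟩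
  obtain ⟨Φ', hΦ'⟩ : ∃ Φ' : (ι → ↥(unitaryGroupOfForm (starRingEnd ℂ) J) ⧸ torusU (starRingEnd ℂ) J) × Ω → E,
      Φ' = fun p => F (fun i => descConj (t i) (torusU (starRingEnd ℂ) J) (LineRing.forall_mem_torusU_comm (starRingEnd ℂ) J (ht i)) (⇑(φ i).symm) (p.1 i), p.2) :=
    ⟨_, rfl⟩
  have hΦc : Continuous Φ := by
    rw [hΦ]
    exact hF.comp ((continuous_pi fun i => (φ i).symm.continuous.comp ((continuous_apply i).comp continuous_fst)).prodMk continuous_snd)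
  have hΦΦ' : ∀ (g : ι → ↥(unitaryGroupOfForm (starRingEnd ℂ) J)) (ω : Ω),
      Φ' (fun i => (QuotientGroup.mk (g i) : ↥(unitaryGroupOfForm (starRingEnd ℂ) J) ⧸ torusU (starRingEnd ℂ) J), ω) = Φ (fun i => g i * t i * (g i)⁻¹, ω) := by
    intro g ω
    rw [hΦ, hΦ']
    rfl
  -- the LHS integrand is `Φ' ∘ f` (★ `descConj_cosetCongr_subgroup`, pointwise)
  have hpt : ∀ q : (∀ i, U i ⧸ T' i) × Ω, F (fun i => descConj (γ i) (T' i) (hγ i) id (q.1 i), q.2) = Φ' (f q) := by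
    intro q
    rw [hΦ', hf]
    refine congrArg F (Prod.ext (funext fun i => ?_) rfl)
    simp only [Prod.map_fst]
    induction q.1 i using QuotientGroup.induction_on with
    | H g =>
      rw [cosetCongr_mk, descConj_mk, descConj_mk, ← hφγ i]
      change g * γ i * g⁻¹ = (φ i).symm ((φ i) g * (φ i) (γ i) * ((φ i) g)⁻¹)
      rw [← map_mul, ← map_inv, ← map_mul, ContinuousMulEquiv.symm_apply_apply]
  -- ★ (A3) on the transported side
  have hμC' : ∀ i, μ' i = C i • Measure.map
      (fun p : ↥(K i) × ↥(unipotentU (starRingEnd ℂ) J) =>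
        (QuotientGroup.mk ((p.1 : ↥(unitaryGroupOfForm (starRingEnd ℂ) J)) * (p.2 : ↥(unitaryGroupOfForm (starRingEnd ℂ) J))) :
          ↥(unitaryGroupOfForm (starRingEnd ℂ) J) ⧸ torusU (starRingEnd ℂ) J))
      ((κ i).prod (μN i)) := fun i => by rw [hμ'i i]; exact hμC i
  have hA3 := prod_normaliser_smul_integral_pi_eq_smul_integral_pi_prod hJ K κ μN μ' hμC' ht hs htms c hx hdt hdtc hds hdsc ρ Φ hΦc Φ' hΦΦ'
  calc _ = (∏ i, (|Real.exp (c i 0) - Real.exp (-c i 0)| * ‖Complex.exp ((c i 0 : ℂ) + (c i 2 : ℂ) * I) - Complex.exp ((c i 1 : ℂ) * I)‖ *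
        ‖Complex.exp (-(c i 0 : ℂ) + (c i 2 : ℂ) * I) - Complex.exp ((c i 1 : ℂ) * I)‖)) • ∫ q, Φ' (f q) ∂((Measure.pi μ).prod ρ) := by
        rw [integral_congr_ae (Filter.Eventually.of_forall hpt)]
    _ = _ • ∫ y, Φ' y ∂((Measure.pi μ').prod ρ) := by rw [hfmp.integral_comp' (f := f)]
    _ = _ := hA3
    _ = _ := by rw [hΦ]

end TransportPi

end UnitaryGroup

end Literature.NumberTheory.Automorphic

end
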